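/-
COR-CM (cell pub-hodgecm2, stage 2 of the Hodge ladder) — count-neutral KERNEL COMBINATORICS «dicyclic twist: the number of blocks for EVERY finite
abelian A» (seat prover-pub-hodgecm2-b23-g43-0, binder prover b23, gen 43; claim DICYCLIC-EVEN, HOME/INBOX.md l.10881; blanket `Census/DicyclicTwist*`).
Theorems only, on top of `Census/DicyclicTwistBlockCount.lean` (gen 42) and seat b09's Burnside count `Census/BlockParityBurnside.lean` used BY NAME;
no `decide` beyond closed numerals in `ZMod 4`, no certificate, no named fact, no `sorry`; `Interfaces.lean` (C1), every E term, B01, `Transposition/*`,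
`PortJoin/*` untouched.
HONEST FRAMING: `HC_CM` is NOT proved, here or anywhere in the tree; nothing here is a period, a count of record or a headline.
T5: n/a-class (hypothesis binders: the dicyclic datum, `c * c = 1`); checker: self, 2026-08-23.
-/
import Summits.HodgeConjecture.CorCM.Census.DicyclicTwistBlockCount

/-!
# The dicyclic twist: `β(G, c) · 4|A| = Σ_{s ∈ A} (1 + [ord s even]) · 4^{|A| / ord s}` for every finite abelian `A`

Along a dicyclic datum `D` on `(G, c)` over ANY finite abelian group `A` (`Census/DicyclicTwistDictionary.lean`; `G ≅ Dic(ℤ/2 × A, c)`), seat b09's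
Burnside count `β · |G| = Σ_g [c ∉ ⟨g⟩] 2^{|G|/ord g/2}` (`Census/BlockParityBurnside.lean`) evaluates in closed form.  The elements `x·ι a` square to
`c` (no contribution, gen 42); **`c ∈ ⟨ι(e, s)⟩ ↔ e = 1 ∧ ord s odd`** (`c_mem_zpowers_ι_iff_odd`, no parity hypothesis on `|A|`); `ord ι(0,s) = ord s`
and, for `ord s` even, `ord ι(1,s) = lcm(2, ord s) = ord s`.  Hence

  **`β(G, c) · 4|A| = Σ_{s ∈ A} (1 + [ord s even]) · 4^{|A| / ord s}`** (`card_block_mul_four_card_eq_sum`),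

which for `|A|` odd is gen 42's `Σ_s 4^{|A|/ord s}` (`card_block_mul_four_card`), and gives e.g. **`β = 19` for `A = ℤ/4`** (`G = ℤ/4 ⋊ ℤ/4` of order `16`, `card_block_eq_nineteen`),
**`β · 4|A| = 4^{|A|} + 2(|A| − 1)·4^{|A|/2}` for `A` of exponent two** (`card_block_mul_four_card_of_two_nsmul_eq_zero`; `β = 22` for `A = (ℤ/2)²`,
where `G = ℤ/4 × (ℤ/2)²` is abelian).  With the dicyclic law for every `A` (this lane) these are the block counts of the census rows.  All [folklore].

## References
* [Milne1999] J. S. Milne, Lefschetz motives and the Tate conjecture, Compositio Math. 117 (1999), Prop. 2.1, p. 54.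
-/

namespace Summit.HodgeConjecture.CorCM.Census.DicyclicTwist

open Finset
open Summit.HodgeConjecture.CorCM.Prior.AllgGroup.RfwfAllgGroup
open Summit.HodgeConjecture.CorCM.Census.BlockParity

noncomputable section

variable {G : Type*} [Group G] [Fintype G] [DecidableEq G] {c : G}
variable {A : Type} [AddCommGroup A] [Fintype A] [DecidableEq A]
variable (D : Datum G c A)

/-! ## §1 Which elements of `ι(ℤ/2 × A)` have `c` among their powers -/

omit [Fintype G] [DecidableEq G] [Fintype A] [DecidableEq A] in
/-- **`c ∈ ⟨ι(e, s)⟩ ↔ e = 1 ∧ ord s` odd** (every finite abelian `A`). [folklore] -/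
theorem c_mem_zpowers_ι_iff_odd (e : ZMod 2) (s : A) : c ∈ Subgroup.zpowers (D.ι (e, s)) ↔ e = 1 ∧ Odd (addOrderOf s) := by
  constructor
  · intro h
    obtain ⟨k, hk⟩ := Subgroup.mem_zpowers_iff.mp h
    rw [ι_zpow] at hk
    have hks : k • ((e, s) : ZMod 2 × A) = ((1 : ZMod 2), (0 : A)) := D.inj (hk.trans D.map_c.symm)
    have h1 : k • e = 1 := by simpa using congrArg Prod.fst hks
    have h2 : k • s = 0 := by simpa using congrArg Prod.snd hks
    -- `k` is odd: `k • e = 1` in `ℤ/2`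
    have hkodd : Odd k := by
      rcases Int.even_or_odd k with ⟨j, rfl⟩ | hodd
      · exfalso
        have key2 : ∀ u : ZMod 2, u + u = 0 := by decide
        rw [add_zsmul, key2] at h1
        exact zero_ne_one h1
      · exact hodd
    have key : ∀ u : ZMod 2, u ≠ 0 → u = 1 := by decide
    refine ⟨key e fun he => ?_, ?_⟩
    · rw [he, smul_zero] at h1
      exact zero_ne_one h1
    · -- `ord s ∣ k` with `k` odd
      have hdvd : (addOrderOf s : ℤ) ∣ k := addOrderOf_dvd_iff_zsmul_eq_zero.mpr h2
      obtain ⟨j, hj⟩ := hkodd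
      rw [Int.natCast_dvd] at hdvd
      have hodd' : Odd k.natAbs := by
        rw [Int.natAbs_odd]
        exact ⟨j, hj⟩
      exact hodd'.of_dvd_nat hdvd
  · rintro ⟨rfl, hodd⟩
    refine Subgroup.mem_zpowers_iff.mpr ⟨(addOrderOf s : ℤ), ?_⟩
    have hn : addOrderOf s • ((1 : ZMod 2), s) = (1, 0) := by
      rw [Prod.smul_mk, addOrderOf_nsmul_eq_zero, nsmul_eq_mul, mul_one, ← ZMod.natCast_mod, Nat.odd_iff.mp hodd, Nat.cast_one]
    rw [zpow_natCast, ι_pow, hn]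
    exact D.map_c

omit [Fintype G] [DecidableEq G] [Fintype A] [DecidableEq A] in
/-- For `ord s` even, `ord (1, s) = ord s` in `ℤ/2 × A`. [folklore] -/
theorem addOrderOf_one_mk_of_even {s : A} (hs : Even (addOrderOf s)) : addOrderOf (((1 : ZMod 2), s) : ZMod 2 × A) = addOrderOf s := by
  rw [Prod.addOrderOf_mk, ZMod.addOrderOf_one]
  exact Nat.lcm_eq_right (even_iff_two_dvd.mp hs)

/-! ## §2 The count for every `A` -/

omit [DecidableEq A] in
include D in
/-- **`β(G, c) · 4|A| = Σ_{s ∈ A} (1 + [ord s even]) · 4^{|A| / ord s}`** for EVERY finite abelian `A` (seat b09's Burnside count evaluated along the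
datum). [folklore] -/
theorem card_block_mul_four_card_eq_sum (hc2 : c * c = 1) :
    Fintype.card (BlockParity.Block c) * (4 * Fintype.card A) =
      ∑ s : A, (if Even (addOrderOf s) then 2 else 1) * 4 ^ (Fintype.card A / addOrderOf s) := by
  classical
  rw [← card_eq_four_mul D, card_block_mul_card c hc2 (mul_c_comm D)]
  -- reindex the sum over `G` along `(ℤ/2 × A) ⊕ (ℤ/2 × A) ≃ G`
  have hb : Function.Bijective (Sum.elim D.ι fun a => D.x * D.ι a : (ZMod 2 × A) ⊕ (ZMod 2 × A) → G) := by
    constructor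
    · rintro (a | a) (b | b) h
      · exact congrArg Sum.inl (D.inj h)
      · exact absurd (h : D.ι a = D.x * D.ι b) (ι_ne_xι D a b)
      · exact absurd (h : D.x * D.ι a = D.ι b).symm (ι_ne_xι D b a)
      · exact congrArg Sum.inr (xι_injective D (h : D.x * D.ι a = D.x * D.ι b))
    · intro g
      obtain ⟨a, rfl | rfl⟩ := D.exhaust g
      · exact ⟨Sum.inl a, rfl⟩
      · exact ⟨Sum.inr a, rfl⟩
  rw [← Equiv.sum_comp (Equiv.ofBijective _ hb), Fintype.sum_sum_type]
  simp only [Equiv.ofBijective_apply, Sum.elim_inl, Sum.elim_inr, c_mem_zpowers_xι D, if_true, Finset.sum_const_zero, add_zero]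
  rw [Fintype.sum_prod_type_right]
  refine Finset.sum_congr rfl fun s _ => ?_
  have huniv : (Finset.univ : Finset (ZMod 2)) = {0, 1} := by decide
  have h0 : ¬ (c ∈ Subgroup.zpowers (D.ι (0, s))) := fun h => zero_ne_one ((c_mem_zpowers_ι_iff_odd D 0 s).mp h).1
  rw [huniv, Finset.sum_pair (show (0 : ZMod 2) ≠ 1 by decide), if_neg h0, orderOf_ι, addOrderOf_zero_mk, card_eq_four_mul D]
  obtain ⟨d, hd⟩ := addOrderOf_dvd_card (x := s)
  have hpos : 0 < addOrderOf s := addOrderOf_pos s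
  have hdiv : Fintype.card A / addOrderOf s = d := by rw [hd, Nat.mul_div_cancel_left d hpos]
  have hdiv' : 4 * Fintype.card A / addOrderOf s / 2 = 2 * d := by
    rw [hd, show 4 * (addOrderOf s * d) = addOrderOf s * (4 * d) by ring, Nat.mul_div_cancel_left _ hpos]
    omega
  rw [hdiv, hdiv', pow_mul, show (2 : ℕ) ^ 2 = 4 by norm_num]
  by_cases hev : Even (addOrderOf s)
  · -- `e = 1`: `c ∉ ⟨ι(1,s)⟩`, `ord ι(1,s) = ord s`
    have h1 : ¬ (c ∈ Subgroup.zpowers (D.ι (1, s))) := fun h =>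
      (Nat.not_odd_iff_even.mpr hev) ((c_mem_zpowers_ι_iff_odd D 1 s).mp h).2
    rw [if_neg h1, if_pos hev, orderOf_ι, addOrderOf_one_mk_of_even hev, hdiv']
    rw [pow_mul, show (2 : ℕ) ^ 2 = 4 by norm_num]
    ring
  · have h1 : c ∈ Subgroup.zpowers (D.ι (1, s)) := (c_mem_zpowers_ι_iff_odd D 1 s).mpr ⟨rfl, Nat.not_even_iff_odd.mp hev⟩
    rw [if_pos h1, if_neg hev]
    ring

/-! ## §3 Exponent two and the numerals `β = 22`, `β = 19` -/

omit [DecidableEq A] in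
include D in
/-- **`A` of exponent two** (`2s = 0` for all `s`): `β(G, c) · 4|A| = 4^{|A|} + (|A| − 1) · (2 · 4^{|A|/2})` (here `G = ℤ/4 × A` is abelian and
`c = (2, 0)`: seat b09's quartic twist without screw). [folklore] -/
theorem card_block_mul_four_card_of_two_nsmul_eq_zero (hc2 : c * c = 1) (h2 : ∀ s : A, s + s = 0) :
    Fintype.card (BlockParity.Block c) * (4 * Fintype.card A) =
      4 ^ Fintype.card A + (Fintype.card A - 1) * (2 * 4 ^ (Fintype.card A / 2)) := by
  classical
  rw [card_block_mul_four_card_eq_sum D hc2, ← Finset.add_sum_erase _ _ (Finset.mem_univ (0 : A)), addOrderOf_zero, Nat.div_one,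
    if_neg (by decide), one_mul]
  congr 1
  have hterm : ∀ s ∈ (Finset.univ : Finset A).erase 0, (if Even (addOrderOf s) then 2 else 1) * 4 ^ (Fintype.card A / addOrderOf s) =
      2 * 4 ^ (Fintype.card A / 2) := by
    intro s hs
    have hs0 : s ≠ 0 := Finset.ne_of_mem_erase hs
    have hord : addOrderOf s = 2 := by
      have hle : addOrderOf s ≤ 2 := by
        refine addOrderOf_le_of_nsmul_eq_zero (by norm_num) ?_
        rw [two_nsmul]; exact h2 s
      have hpos : 0 < addOrderOf s := addOrderOf_pos s
      have hne1 : addOrderOf s ≠ 1 := fun h => hs0 (AddMonoid.addOrderOf_eq_one_iff.mp h)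
      omega
    rw [hord, if_pos even_two]
  rw [Finset.sum_congr rfl hterm, Finset.sum_const, smul_eq_mul, Finset.card_erase_of_mem (Finset.mem_univ _), Finset.card_univ]

omit [DecidableEq A] in
include D in
/-- **`β = 22` for `A = (ℤ/2)²`** (`|A| = 4` of exponent two; `G = ℤ/4 × (ℤ/2)²`, `c = (2,0,0)`). [folklore] -/
theorem card_block_eq_twentyTwo (hc2 : c * c = 1) (h4 : Fintype.card A = 4) (h2 : ∀ s : A, s + s = 0) :
    Fintype.card (BlockParity.Block c) = 22 := by
  have h := card_block_mul_four_card_of_two_nsmul_eq_zero D hc2 h2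
  rw [h4] at h
  norm_num at h
  omega

/-- **`β = 19` for `A = ℤ/4`** (`G = Dic(ℤ/2 × ℤ/4, c) = ℤ/4 ⋊ ℤ/4` of order `16`): the orders in `ℤ/4` are `1, 4, 2, 4`, so
`β · 16 = 4⁴ + 2·4 + 2·4² + 2·4 = 304`. [folklore] -/
theorem card_block_eq_nineteen {G : Type*} [Group G] [Fintype G] [DecidableEq G] {c : G} (D : Datum G c (ZMod 4)) (hc2 : c * c = 1) :
    Fintype.card (BlockParity.Block c) = 19 := by
  have h := card_block_mul_four_card_eq_sum D hc2
  have hcard : Fintype.card (ZMod 4) = 4 := ZMod.card 4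
  have ho0 : addOrderOf (0 : ZMod 4) = 1 := addOrderOf_zero
  have ho1 : addOrderOf (1 : ZMod 4) = 4 := ZMod.addOrderOf_one 4
  have ho2 : addOrderOf (2 : ZMod 4) = 2 := by
    have h := ZMod.addOrderOf_coe 2 (n := 4) (by norm_num)
    norm_num at h
    exact h
  have ho3 : addOrderOf (3 : ZMod 4) = 4 := by
    have h := ZMod.addOrderOf_coe 3 (n := 4) (by norm_num)
    norm_num at h
    exact h
  have huniv : (Finset.univ : Finset (ZMod 4)) = {0, 1, 2, 3} := by decide
  rw [hcard, huniv] at h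
  rw [Finset.sum_insert (by decide), Finset.sum_insert (by decide), Finset.sum_pair (by decide), ho0, ho1, ho2, ho3] at h
  norm_num at h
  omega

end

end Summit.HodgeConjecture.CorCM.Census.DicyclicTwist
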